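import Summits.BirchSwinnertonDyer.Rank1Residual.X11a.SelmerCompanionTwistedNorm
import Summits.BirchSwinnertonDyer.Rank1Residual.X11a.SelmerCompanionNonsplit
import Literature.NumberTheory.EllipticCurves.SpectralValuationUnramified
import Literature.NumberTheory.EllipticCurves.GeomPointsGaloisModule
import Literature.NumberTheory.EllipticCurves.CongruenceVisibility
import HarnessLib

/-!
# Route (3e) SELMER COMPANION, XIV: at a SPLIT multiplicative place `v ∤ p` with `μ_p(K_v) = 1`,
# a class that is Selmer AND unramified restricts to ZERO in `H¹(K_v, E[p])`
# (class X11a = N7; cell `b2b-bsdres`, unit `b2b-bsdres-x11a`, gen 28)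

HONEST FRAMING (run/shared/lean/b2b/bsd-rank1-residual/, verbatim in every file): the goal of the
cell is to DELETE the COMBINATION-SHAPED residual classes of the Birch–Swinnerton-Dyer formula for
ALL analytic-rank `≤ 1` elliptic curves over `ℚ` — "full BSD formula for every rank `≤ 1` curve in
class `C`" assembled STRICTLY from published theorems — so that the rank-`≤ 1` remainder becomes
exactly the CONSTRUCTION-SHAPED classes, which are TYPED (missing-input `Prop`s), NOT attempted.
This is not "finishing BSD". CLASS-OWNERS.md: research routes; NO CLAIM BEYOND STATED CLASSES.
THEOREMS ONLY; nothing booked; no label moves. CONDITIONAL on the PUBLISHED named fact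
`Silverman1994_thmV53_tateUniformisation` (Tate uniformisation, `hU` = A40).

## What is proved

* `res_eq_zero_of_split_of_selmer_of_unramified` — for `E = W` over a number field `K`, `p` prime,
  `v ∤ p` a place of SPLIT multiplicative reduction with `p ∤ q_v − 1` (no `p`-th roots of unity in
  `K_v`; over `ℚ`: `ℓ ≢ 1 (mod p)`): a class of `H¹(K, E[p])` that is Selmer at `v` AND unramified
  at `v` restricts to ZERO in `H¹(K_v, E[p])`. (When `p ∣ ord_v(q)` the Kummer image
  `E(K_v)/p ≅ ℤ/p` is generated by the class of the uniformiser, which is ramified; when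
  `p ∤ ord_v(q)` it is `0`. Contrast the NON-split case, files IV/XI-b, where Selmer = unramified.)
  Proof via Tate's `Φ : K̄_v^× → E(K̄_v)` [`hU`]: the Selmer point corrected by the unramified
  trivialiser is `Φ(α)` with `α` fixed by inertia, so `α = ε ϖ^k` with `ε` an `I`-fixed unit
  (value group of `K_v^nr`, tree `exists_spectralValuation_eq_pow_of_forall_inertia`) and
  `σ(ε^p) = ε^p`; for a Frobenius `F`, `η = F(ε)/ε ∈ μ_p` equals `F(ξ)/ξ` for the `p`-th root of
  unity `ξ = η^d`, `d(q_v−1) ≡ 1 (mod p)` (Serre IV §4 Prop. 16), so `Φ(ε) − Φ(ξ)` is fixed by `F`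
  and `I`, hence by `Γ_{K_v}` (open stabiliser; Neukirch II §9), and the restricted cocycle is the
  coboundary of a `p`-torsion point.
* `res_h1Equiv_eq_zero_of_split_of_good` — along `θ : E[p] ≃ A[p]` with `A` GOOD at such a place
  (a level-lowered partner; `ι_v(θ) = p` is sharp there), every class of `θ_* 𝓢_v(E) ∩ 𝓢_v(A)`
  restricts to zero at `v`. So if `Sel^(p)(A) → H¹(K_v, A[p])` is injective — for a rank-one
  partner: its generator is not `p`-divisible in `A(K_v)` — the strict count of file XIII bounds
  `#Sel^(p)(E)` by the local budget ALONE, without the factor `p^{rank A}` (file XV).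

References: [SilvermanATAEC1994] Ch. V Thm. 3.1, Thm. 5.3; [SerreLocalFields1979] IV §4 Prop. 16;
[NeukirchANT1999] II (7.5), §9 (9.9)–(9.11); [MazurRubin2004] §2.3; HOME/b2b-bsdres-x11a/REPORT-g28.md.
-/

set_option autoImplicit false

noncomputable section

open scoped Classical NNReal Topology

open WeierstrassCurve Literature.NumberTheory.EllipticCurves
  Literature.NumberTheory.GaloisRepresentations Field NumberField IsDedekindDomain
  IsDedekindDomain.HeightOneSpectrum

namespace Summit.BirchSwinnertonDyer.Rank1Residual.X11a.SelmerCompanion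

section Local

variable {K : Type} [Field K] [NumberField K] (W : WeierstrassCurve K) [W.IsElliptic]
  {p : ℕ} [hp : Fact p.Prime] (v : HeightOneSpectrum (𝓞 K))

/-- **At a SPLIT multiplicative place `v ∤ p` with `p ∤ q_v − 1`, Selmer ∧ unramified ⟹ locally
zero**: for `E = W` split multiplicative at `v`, `𝔓 = 𝔓_{ι,𝔐}`, a class of `H¹(K, E[p])` in
`𝓢_v(E) = selmerLocalKer` and in `unramifiedKer (E[p]) 𝔓` has `res_v c = 0` in `H¹(K_v, E[p])`.
Proof in the module docstring. CONDITIONAL on `hU`.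
[cite: SilvermanATAEC1994, Ch. V Thm. 3.1 (c),(d), Thm. 5.3 (a),(b)]
[cite: SerreLocalFields1979, Ch. IV §4 Prop. 16] [cite: NeukirchANT1999, Ch. II Prop. (7.5), §9 Prop. (9.9)–(9.11)] -/
theorem res_eq_zero_of_split_of_selmer_of_unramified
    (hU : Silverman1994_thmV53_tateUniformisation.{0})
    (hW : W.HasSplitMultiplicativeReductionAt v) (hpv : (p : 𝓞 K) ∉ v.asIdeal)
    (hq : ¬ p ∣ Nat.card (IsLocalRing.ResidueField (v.adicCompletionIntegers K)) - 1)
    {𝔐 : Ideal v.localAbsIntegers} (h𝔐 : 𝔐 ∈ v.localPrimesAbove)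
    {c : galH1Torsion W (p : ℤ)} (hc : c ∈ selmerLocalKer W (v.adicCompletion K) (p : ℤ))
    (hur : c ∈ unramifiedKer (geomTorsion W (p : ℤ))
      (v.primeBelow (closureEmb (K := K) (v.adicCompletion K)) 𝔐)) :
    galoisCohomology.res (W.torsionGaloisModule (p : ℤ)) (v.adicCompletion K) 1 c = 0 := by
  have hpp : p.Prime := hp.out
  haveI : CharZero (v.adicCompletion K) := charZero_adicCompletion v
  have hn : (p : ℤ) ≠ 0 := by exact_mod_cast hpp.ne_zero
  obtain ⟨w, hw⟩ := v.exists_spectralValuation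
  set qv := Nat.card (IsLocalRing.ResidueField (v.adicCompletionIntegers K)) with hqv
  have hwp : w (p : AlgebraicClosure (v.adicCompletion K)) = 1 := by
    have h := spectralValuation_intCast_eq_one hw (n := (p : ℤ)) (by rwa [Int.cast_natCast])
    rwa [Int.cast_natCast] at h
  -- the cocycle, the Selmer point `a'`, the unramified trivialiser `T₀`
  obtain ⟨φ, rfl⟩ :=
    oneCocycleClass_surjective (discreteTopRep (absoluteGaloisGroup K) (geomTorsion W (p : ℤ))) c
  have hc' := hc
  rw [selmerLocalKer, oneCocycleClass_mem_resKer_iff] at hc'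
  obtain ⟨a', ha'⟩ := hc'
  have ha'' : ∀ σ : (absoluteGaloisGroup (v.adicCompletion K)), pointsMap W (v.adicCompletion K)
      ((φ.1 (resGal (K := K) (v.adicCompletion K) σ) : geomTorsion W (p : ℤ)) :
      geomPoints W) = σ • a' - a' := fun σ ↦ ha' σ
  obtain ⟨T₀, hT₀⟩ := (oneCocycleClass_mem_subgroupResKer_iff _ φ).mp hur
  set T₀' : localPoints W (v.adicCompletion K) :=
    pointsMap W (v.adicCompletion K) (T₀ : geomPoints W) with hT₀'
  have hpT₀' : (p : ℤ) • T₀' = 0 := by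
    rw [hT₀', ← map_zsmul, (mem_geomTorsion_iff W _ _).mp T₀.2, map_zero]
  -- `p a'` is rational
  have hP'fix : ∀ σ : (absoluteGaloisGroup (v.adicCompletion K)), σ • ((p : ℤ) • a') = (p : ℤ)
      • a' := by
    intro σ
    have h0 : (p : ℤ) • (σ • a' - a') = 0 := by
      rw [← ha'' σ, ← map_zsmul, (mem_geomTorsion_iff W _ _).mp (φ.1 _).2, map_zero]
    rw [W.smul_zsmul_localPoints (p : ℤ) σ a']
    rw [zsmul_sub, sub_eq_zero] at h0
    exact h0
  -- `a'' = a' - T₀'` is fixed by the local inertia group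
  set a'' : localPoints W (v.adicCompletion K) := a' - T₀' with ha''def
  have ha''I : ∀ τ ∈ 𝔐.inertia (absoluteGaloisGroup (v.adicCompletion K)), τ • a'' = a'' := by
    intro τ hτ
    have hτ' := v.resGalOfEmb_mem_inertia_primeBelow (closureEmb (K := K) (v.adicCompletion K)) 𝔐 hτ
    have h1 : φ.1 (resGal (K := K) (v.adicCompletion K) τ) =
        resGal (K := K) (v.adicCompletion K) τ • T₀ - T₀ := by
      rw [resGal_eq]
      exact hT₀ ⟨_, hτ'⟩
    have h2 := ha'' τ
    rw [h1, AddSubgroup.coe_sub, map_sub,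
      Literature.NumberTheory.EllipticCurves.AddSubgroup.torsionBy.coe_smul, pointsMap_smul,
      ← hT₀'] at h2
    rw [ha''def, smul_sub]
    calc τ • a' - τ • T₀' = (τ • a' - a') - (τ • T₀' - T₀') + (a' - T₀') := by abel
      _ = a' - T₀' := by rw [← h2, sub_self, zero_add]
  have hpa'' : ∀ σ : (absoluteGaloisGroup (v.adicCompletion K)), σ • ((p : ℤ) • a'') = (p : ℤ)
      • a'' := by
    intro σ
    rw [ha''def, zsmul_sub, hpT₀', sub_zero, hP'fix]
  -- Tate's parametrisation of `E` at `v`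
  obtain ⟨q, Φ, hq0, hq1, hsurj, hker, hequiv, -⟩ := hU W v hW
  set gal : absoluteGaloisGroup (v.adicCompletion K) →
      (AlgebraicClosure (v.adicCompletion K))ˣ →* (AlgebraicClosure (v.adicCompletion K))ˣ :=
    fun σ ↦ Units.map (Field.absoluteGaloisGroup.toAlgEquiv (v.adicCompletion K) σ :
      AlgebraicClosure (v.adicCompletion K) →* AlgebraicClosure (v.adicCompletion K)) with hgal
  have hgal_coe : ∀ (σ : absoluteGaloisGroup (v.adicCompletion K))
      (u : (AlgebraicClosure (v.adicCompletion K))ˣ),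
      ((gal σ u : (AlgebraicClosure (v.adicCompletion K))ˣ) :
        AlgebraicClosure (v.adicCompletion K)) = σ • (u : AlgebraicClosure (v.adicCompletion K)) :=
    fun σ u ↦ rfl
  have hequiv' : ∀ (σ : absoluteGaloisGroup (v.adicCompletion K))
      (u : (AlgebraicClosure (v.adicCompletion K))ˣ),
      σ • Φ (Additive.ofMul u) = Φ (Additive.ofMul (gal σ u)) := fun σ u ↦ hequiv σ u
  have hQe0 : algebraMap (v.adicCompletion K) (AlgebraicClosure (v.adicCompletion K)) q ≠ 0 :=
    (map_ne_zero _).mpr hq0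
  set Q : (AlgebraicClosure (v.adicCompletion K))ˣ := Units.mk0 _ hQe0 with hQ
  have hQval : (Q : AlgebraicClosure (v.adicCompletion K)) =
      algebraMap (v.adicCompletion K) (AlgebraicClosure (v.adicCompletion K)) q := by
    rw [hQ, Units.val_mk0]
  have hwQ : w (Q : AlgebraicClosure (v.adicCompletion K)) < 1 := by
    rw [hQval, ← NNReal.coe_lt_coe, coe_spectralValuation_algebraMap hw, NNReal.coe_one,
      Valued.toNormedField.norm_lt_one_iff]
    exact hq1
  have hker1 : ∀ η : (AlgebraicClosure (v.adicCompletion K))ˣ,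
      w (η : AlgebraicClosure (v.adicCompletion K)) = 1 → Φ (Additive.ofMul η) = 0 → η = 1 := by
    intro η hwη hη
    obtain ⟨k, hk⟩ := (hker η).mp hη
    have hk0 : k = 0 := by
      have h4 : w (Q : AlgebraicClosure (v.adicCompletion K)) ^ k = 1 := by
        rw [← map_zpow₀, hQval, ← hk, hwη]
      have hQpos : 0 < w (Q : AlgebraicClosure (v.adicCompletion K)) :=
        (Valuation.pos_iff w).mpr (Units.ne_zero Q)
      exact zpow_right_injective₀ hQpos hwQ.ne (h4.trans (zpow_zero _).symm)
    exact Units.ext (by rw [hk, hk0, zpow_zero, Units.val_one])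
  -- fixed points of `Φ(u)` under `σ` with `|σ u / u| = 1`: `σ u = u`
  have hfixed : ∀ (σ : absoluteGaloisGroup (v.adicCompletion K))
      (u : (AlgebraicClosure (v.adicCompletion K))ˣ),
      σ • Φ (Additive.ofMul u) = Φ (Additive.ofMul u) → gal σ u = u := by
    intro σ u h
    have h1 : Φ (Additive.ofMul (gal σ u * u⁻¹)) = 0 := by
      rw [ofMul_mul, ofMul_inv, map_add, map_neg, ← hequiv' σ u, h, add_neg_cancel]
    have h2 : w ((gal σ u * u⁻¹ : (AlgebraicClosure (v.adicCompletion K))ˣ) :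
        AlgebraicClosure (v.adicCompletion K)) = 1 := by
      rw [Units.val_mul, Units.val_inv_eq_inv_val, map_mul, map_inv₀, hgal_coe,
        spectralValuation_smul hw σ _, mul_inv_cancel₀]
      exact (Valuation.ne_zero_iff w).mpr u.ne_zero
    have h3 := hker1 _ h2 h1
    rwa [mul_inv_eq_one] at h3
  -- `a'' = Φ(α)`, `α` fixed by `I`, `σ(α^p) = α^p`
  obtain ⟨x, hx⟩ := hsurj a''
  set α : (AlgebraicClosure (v.adicCompletion K))ˣ := Additive.toMul x with hα
  have hxα : Φ (Additive.ofMul α) = a'' := by rw [hα]; exact hx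
  have hαI : ∀ τ ∈ 𝔐.inertia (absoluteGaloisGroup (v.adicCompletion K)), gal τ α = α :=
    fun τ hτ ↦ hfixed τ α (by rw [hxα]; exact ha''I τ hτ)
  have hαp : ∀ σ : absoluteGaloisGroup (v.adicCompletion K), gal σ (α ^ p) = α ^ p :=
    fun σ ↦ hfixed σ (α ^ p) (by
      rw [ofMul_pow, map_nsmul, hxα, ← natCast_zsmul]
      exact hpa'' σ)
  -- the valuation of `α` is an integral power of `|ϖ|_v`
  obtain ⟨ϖ, hϖ⟩ := IsDiscreteValuationRing.exists_irreducible (v.adicCompletionIntegers K)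
  obtain ⟨hϖ0, hϖ1⟩ := spectralValuation_uniformizer_pos_lt_one hw hϖ
  have hϖe0 : algebraMap (v.adicCompletion K) (AlgebraicClosure (v.adicCompletion K))
      (ϖ : v.adicCompletion K) ≠ 0 := (Valuation.pos_iff w).mp hϖ0
  set ϖ₀ : (AlgebraicClosure (v.adicCompletion K))ˣ := Units.mk0 _ hϖe0 with hϖ₀
  have hϖ₀val : (ϖ₀ : AlgebraicClosure (v.adicCompletion K)) =
      algebraMap (v.adicCompletion K) (AlgebraicClosure (v.adicCompletion K))
        (ϖ : v.adicCompletion K) := by rw [hϖ₀, Units.val_mk0]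
  have hϖ₀σ : ∀ σ : absoluteGaloisGroup (v.adicCompletion K), gal σ ϖ₀ = ϖ₀ := fun σ ↦
    Units.ext (by rw [hgal_coe, hϖ₀val, absoluteGaloisGroup.smul_def, AlgEquiv.commutes])
  have hαI' : ∀ (u : (AlgebraicClosure (v.adicCompletion K))ˣ),
      (∀ τ ∈ 𝔐.inertia (absoluteGaloisGroup (v.adicCompletion K)), gal τ u = u) →
      ∀ τ ∈ 𝔐.inertia (absoluteGaloisGroup (v.adicCompletion K)),
        Field.absoluteGaloisGroup.toAlgEquiv (v.adicCompletion K) τ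
          (u : AlgebraicClosure (v.adicCompletion K)) = u := by
    intro u hu τ hτ
    have h := congrArg Units.val (hu τ hτ)
    rwa [hgal_coe, absoluteGaloisGroup.smul_def] at h
  have hval : ∃ k : ℤ, w (α : AlgebraicClosure (v.adicCompletion K)) =
      w (ϖ₀ : AlgebraicClosure (v.adicCompletion K)) ^ k := by
    have hα0 : 0 < w (α : AlgebraicClosure (v.adicCompletion K)) :=
      (Valuation.pos_iff w).mpr α.ne_zero
    rcases lt_trichotomy (w (α : AlgebraicClosure (v.adicCompletion K))) 1 with h | h | h
    · obtain ⟨m, -, hm⟩ := exists_spectralValuation_eq_pow_of_forall_inertia hw h𝔐 hϖ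
        (hαI' α hαI) hα0 h
      exact ⟨m, by rw [zpow_natCast, hϖ₀val]; exact hm⟩
    · exact ⟨0, by rw [zpow_zero]; exact h⟩
    · have hinvI : ∀ τ ∈ 𝔐.inertia (absoluteGaloisGroup (v.adicCompletion K)), gal τ α⁻¹ = α⁻¹ :=
        fun τ hτ ↦ by rw [map_inv, hαI τ hτ]
      have h0 : 0 < w ((α⁻¹ : (AlgebraicClosure (v.adicCompletion K))ˣ) :
          AlgebraicClosure (v.adicCompletion K)) := (Valuation.pos_iff w).mpr (α⁻¹).ne_zero
      have h1 : w ((α⁻¹ : (AlgebraicClosure (v.adicCompletion K))ˣ) :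
          AlgebraicClosure (v.adicCompletion K)) < 1 := by
        rw [Units.val_inv_eq_inv_val, map_inv₀]
        exact inv_lt_one_of_one_lt₀ h
      obtain ⟨m, -, hm⟩ := exists_spectralValuation_eq_pow_of_forall_inertia hw h𝔐 hϖ
        (hαI' α⁻¹ hinvI) h0 h1
      refine ⟨-(m : ℤ), ?_⟩
      rw [Units.val_inv_eq_inv_val, map_inv₀] at hm
      rw [zpow_neg, zpow_natCast, hϖ₀val, ← hm, inv_inv]
  obtain ⟨k, hk⟩ := hval
  -- the `I`-fixed unit `ε = α ϖ^{-k}`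
  set ε : (AlgebraicClosure (v.adicCompletion K))ˣ := α * ϖ₀ ^ (-k) with hε
  have hwε : w (ε : AlgebraicClosure (v.adicCompletion K)) = 1 := by
    have hϖw0 : w (ϖ₀ : AlgebraicClosure (v.adicCompletion K)) ≠ 0 :=
      (Valuation.ne_zero_iff w).mpr ϖ₀.ne_zero
    rw [hε, Units.val_mul, Units.val_zpow_eq_zpow_val, map_mul, map_zpow₀, hk, ← zpow_add₀ hϖw0,
      add_neg_cancel, zpow_zero]
  have hεI : ∀ τ ∈ 𝔐.inertia (absoluteGaloisGroup (v.adicCompletion K)), gal τ ε = ε := by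
    intro τ hτ
    rw [hε, map_mul, map_zpow, hαI τ hτ, hϖ₀σ]
  have hεp : ∀ σ : absoluteGaloisGroup (v.adicCompletion K), gal σ (ε ^ p) = ε ^ p := by
    intro σ
    rw [hε, mul_pow, map_mul, hαp σ, ← zpow_natCast (ϖ₀ ^ (-k)) p, ← zpow_mul, map_zpow, hϖ₀σ]
  -- the cocycle in terms of `ε`: `σ a'' − a'' = Φ(σε/ε)`
  have hcocε : ∀ σ : absoluteGaloisGroup (v.adicCompletion K),
      σ • a'' - a'' = Φ (Additive.ofMul (gal σ ε * ε⁻¹)) := by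
    intro σ
    have hαε : α = ε * ϖ₀ ^ k := by
      rw [hε, mul_assoc, ← zpow_add, neg_add_cancel, zpow_zero, mul_one]
    rw [← hxα, hequiv' σ α, ← map_sub, hαε, map_mul, map_zpow, hϖ₀σ, ofMul_mul, ofMul_mul,
      add_sub_add_right_eq_sub, sub_eq_add_neg, ← ofMul_inv, ← ofMul_mul]
  -- an arithmetic Frobenius; `η = F(ε)/ε ∈ μ_p`; `ξ = η^d` with `d (q_v - 1) ≡ 1 (mod p)`
  obtain ⟨F, hF⟩ := v.exists_isArithFrobAt_localAbsIntegers h𝔐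
  set η : (AlgebraicClosure (v.adicCompletion K))ˣ := gal F ε * ε⁻¹ with hη
  have hFε : gal F ε = η * ε := by rw [hη, inv_mul_cancel_right]
  have hηp : η ^ p = 1 := by
    rw [hη, mul_pow, ← map_pow, inv_pow, hεp F, mul_inv_cancel]
  have hq2 := two_le_natCard_residueField (K := K) (v := v)
  have hcop : Nat.Coprime (qv - 1) p := ((Nat.Prime.coprime_iff_not_dvd hpp).mpr hq).symm
  obtain ⟨d, -, hd⟩ := Nat.exists_mul_mod_eq_one_of_coprime hcop hpp.one_lt
  set e : ℕ := (qv - 1) * d / p with he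
  have hde : (qv - 1) * d = p * e + 1 := by
    have h := Nat.div_add_mod ((qv - 1) * d) p
    rw [hd] at h
    rw [he]
    exact h.symm
  set ξ : (AlgebraicClosure (v.adicCompletion K))ˣ := η ^ d with hξ
  have hξp : ξ ^ p = 1 := by rw [hξ, ← pow_mul, mul_comm, pow_mul, hηp, one_pow]
  have hξp' : (ξ : AlgebraicClosure (v.adicCompletion K)) ^ p = 1 := by
    rw [← Units.val_pow_eq_pow_val, hξp, Units.val_one]
  have hξq : ξ ^ qv = η * ξ := by
    have h1 : qv = (qv - 1) + 1 := by omega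
    conv_lhs => rw [h1]
    rw [pow_succ, hξ, ← pow_mul, mul_comm d, hde, pow_add, pow_one, pow_mul, hηp, one_pow,
      one_mul]
  have hFξ : gal F ξ = η * ξ := by
    apply Units.ext
    rw [hgal_coe, frobenius_smul_eq_pow_of_pow_eq_one hw h𝔐 hF hpp.ne_zero hwp hξp',
      ← Units.val_pow_eq_pow_val, ← hqv, hξq]
  have hIξ : ∀ τ ∈ 𝔐.inertia (absoluteGaloisGroup (v.adicCompletion K)), gal τ ξ = ξ := fun τ hτ ↦
    Units.ext (by
      rw [hgal_coe]
      exact smul_eq_self_of_mem_inertia_of_pow_eq_one hw h𝔐 hτ hpp.ne_zero hwp hξp')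
  -- `b₀ = Φ(ε) − Φ(ξ)` is fixed by `F` and by `I`, hence by `Γ_{K_v}`
  set b₀ : localPoints W (v.adicCompletion K) := Φ (Additive.ofMul ε) - Φ (Additive.ofMul ξ)
    with hb₀
  have hb₀F : F • b₀ = b₀ := by
    rw [hb₀, smul_sub, hequiv' F ε, hequiv' F ξ, hFε, hFξ, ofMul_mul η ε, ofMul_mul η ξ, map_add,
      map_add, add_sub_add_left_eq_sub]
  have hb₀I : ∀ τ ∈ 𝔐.inertia (absoluteGaloisGroup (v.adicCompletion K)), τ • b₀ = b₀ := by
    intro τ hτ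
    rw [hb₀, smul_sub, hequiv' τ ε, hequiv' τ ξ, hεI τ hτ, hIξ τ hτ]
  have hb₀all : ∀ σ : absoluteGaloisGroup (v.adicCompletion K), σ • b₀ = b₀ := by
    set S : Subgroup (absoluteGaloisGroup (v.adicCompletion K)) :=
      MulAction.stabilizer (absoluteGaloisGroup (v.adicCompletion K)) b₀ with hS
    have hStop : S = ⊤ :=
      v.eq_top_of_isOpen_of_frobenius_mem_of_inertia_le h𝔐 hF
        (W.isOpen_stabilizer_localPoints (v.adicCompletion K) b₀)
        ((MulAction.mem_stabilizer_iff).mpr hb₀F)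
        (fun τ hτ ↦ (MulAction.mem_stabilizer_iff).mpr (hb₀I τ hτ))
    exact fun σ ↦ (MulAction.mem_stabilizer_iff).mp (show σ ∈ S by rw [hStop]; trivial)
  have hcocξ : ∀ σ : absoluteGaloisGroup (v.adicCompletion K),
      σ • a'' - a'' = σ • Φ (Additive.ofMul ξ) - Φ (Additive.ofMul ξ) := by
    intro σ
    have h := hb₀all σ
    rw [hb₀, smul_sub] at h
    rw [hcocε σ, ofMul_mul, ofMul_inv, map_add, map_neg, ← hequiv' σ ε, ← sub_eq_add_neg]
    -- `σΦ(ε) − Φ(ε) = σΦ(ξ) − Φ(ξ)` from `σΦ(ε) − σΦ(ξ) = Φ(ε) − Φ(ξ)`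
    calc σ • Φ (Additive.ofMul ε) - Φ (Additive.ofMul ε)
        = (σ • Φ (Additive.ofMul ε) - σ • Φ (Additive.ofMul ξ)) - (Φ (Additive.ofMul ε) -
            Φ (Additive.ofMul ξ)) + (σ • Φ (Additive.ofMul ξ) - Φ (Additive.ofMul ξ)) := by abel
      _ = σ • Φ (Additive.ofMul ξ) - Φ (Additive.ofMul ξ) := by rw [h, sub_self, zero_add]
  -- the `p`-torsion point `T₁ = Φ(ξ)` as an element of `E[p]`
  have hT₁p : (p : ℤ) • Φ (Additive.ofMul ξ) = 0 := by
    rw [natCast_zsmul, ← map_nsmul, ← ofMul_pow, hξp, ofMul_one, map_zero]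
  set eT := W.torsionPointsEquiv (p : ℤ) (E := (v.adicCompletion K)) hn with heT
  set T₁ : geomTorsion W (p : ℤ) :=
    eT.symm ⟨Φ (Additive.ofMul ξ), (Submodule.mem_torsionBy_iff _ _).mpr hT₁p⟩ with hT₁
  have hT₁' : pointsMap W (v.adicCompletion K) (T₁ : geomPoints W) = Φ (Additive.ofMul ξ) := by
    rw [hT₁, heT, W.pointsMap_torsionPointsEquiv_symm (p : ℤ) hn]
  -- conclusion: the restricted cocycle is the coboundary of `T₁ + T₀ ∈ E[p]`
  rw [res_torsionGaloisModule_oneCocycleClass]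
  refine (oneCocycleClass_eq_zero_iff _ _).mpr ⟨T₁ + T₀, fun σ ↦ ?_⟩
  change φ.1 (resGal (K := K) (v.adicCompletion K) σ) =
    resGal (K := K) (v.adicCompletion K) σ • (T₁ + T₀) - (T₁ + T₀)
  apply Subtype.ext
  apply pointsMapOfEmb_injective W (closureEmb (K := K) (v.adicCompletion K))
  change pointsMap W (v.adicCompletion K) _ = pointsMap W (v.adicCompletion K) _
  rw [ha'' σ, AddSubgroup.coe_sub, map_sub, AddSubgroup.coe_add, map_add,
    Literature.NumberTheory.EllipticCurves.AddSubgroup.torsionBy.coe_smul, pointsMap_smul,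
    AddSubgroup.coe_add, map_add, hT₁', ← hT₀']
  calc σ • a' - a' = (σ • a'' - a'') + (σ • T₀' - T₀') := by rw [ha''def, smul_sub]; abel
    _ = (σ • Φ (Additive.ofMul ξ) - Φ (Additive.ofMul ξ)) + (σ • T₀' - T₀') := by rw [hcocξ σ]
    _ = σ • (Φ (Additive.ofMul ξ) + T₀') - (Φ (Additive.ofMul ξ) + T₀') := by
        rw [smul_add]; abel

omit [W.IsElliptic] hp in
/-- **Transport of "restricts to zero" along `θ : E[p] ≃ A[p]`.** If `c ∈ H¹(K, E[p])` restricts to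
zero in `H¹(K_v, E[p])` then `θ_* c` restricts to zero in `H¹(K_v, A[p])`. [folklore] -/
theorem res_h1Equiv_eq_zero_of_res_eq_zero (A : WeierstrassCurve K) [A.IsElliptic]
    (θ : geomTorsion W (p : ℤ) ≃+ geomTorsion A (p : ℤ))
    (hθ : ∀ (σ : absoluteGaloisGroup K) (P : geomTorsion W (p : ℤ)), θ (σ • P) = σ • θ P)
    {c : galH1Torsion W (p : ℤ)}
    (hc : galoisCohomology.res (W.torsionGaloisModule (p : ℤ)) (v.adicCompletion K) 1 c = 0) :
    galoisCohomology.res (A.torsionGaloisModule (p : ℤ)) (v.adicCompletion K) 1 (h1Equiv θ hθ c) =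
      0 := by
  obtain ⟨φ, rfl⟩ :=
    oneCocycleClass_surjective (discreteTopRep (absoluteGaloisGroup K) (geomTorsion W (p : ℤ))) c
  rw [res_torsionGaloisModule_oneCocycleClass] at hc
  obtain ⟨a, ha⟩ := (oneCocycleClass_eq_zero_iff _ _).mp hc
  rw [h1Equiv_oneCocycleClass, res_torsionGaloisModule_oneCocycleClass]
  refine (oneCocycleClass_eq_zero_iff _ _).mpr ⟨θ a, fun σ ↦ ?_⟩
  have h1 : φ.1 (resGal (K := K) (v.adicCompletion K) σ) =
      resGal (K := K) (v.adicCompletion K) σ • a - a := ha σ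
  change θ (φ.1 (resGal (K := K) (v.adicCompletion K) σ)) =
    resGal (K := K) (v.adicCompletion K) σ • θ a - θ a
  rw [h1, map_sub, hθ]

/-- **The strictness lemma for a SPLIT level-lowering place of `E` with a GOOD partner.** Let
`θ : E[p] ≃ A[p]` be `Γ_K`-equivariant, `v ∤ p` a place with `p ∤ q_v − 1` at which `E = W` is SPLIT
multiplicative and `A` has GOOD reduction. Then every class of `θ_* 𝓢_v(E) ∩ 𝓢_v(A)` restricts to
ZERO in `H¹(K_v, A[p])`: a class Selmer for `A` at the good place `v` is unramified (Gross (7.1),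
tree `selmerLocalKer_eq_unramifiedKer`), so its preimage under `θ_*` is unramified AND Selmer for
`E`, hence locally zero (`res_eq_zero_of_split_of_selmer_of_unramified`), and so is its transport.
Consequently a class of `Sel^(p)(A)` lying in `θ_* 𝓢_v(E)` dies in `H¹(K_v, A[p])` — the input of the
strict count of file XIII. [cite: SilvermanATAEC1994, Ch. V Thm. 3.1 (c),(d), Thm. 5.3 (a),(b)]
[cite: GrossLMS1991, §7 (7.1)] [cite: MazurRubin2004, §2.3] -/
theorem res_h1Equiv_eq_zero_of_split_of_good
    (hU : Silverman1994_thmV53_tateUniformisation.{0})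
    (A : WeierstrassCurve K) [A.IsElliptic]
    (θ : geomTorsion W (p : ℤ) ≃+ geomTorsion A (p : ℤ))
    (hθ : ∀ (σ : absoluteGaloisGroup K) (P : geomTorsion W (p : ℤ)), θ (σ • P) = σ • θ P)
    (hW : W.HasSplitMultiplicativeReductionAt v) (hA : A.HasGoodReductionAt v)
    (hpv : (p : 𝓞 K) ∉ v.asIdeal)
    (hq : ¬ p ∣ Nat.card (IsLocalRing.ResidueField (v.adicCompletionIntegers K)) - 1)
    {c : galH1Torsion W (p : ℤ)} (hc : c ∈ selmerLocalKer W (v.adicCompletion K) (p : ℤ))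
    (hcA : h1Equiv θ hθ c ∈ selmerLocalKer A (v.adicCompletion K) (p : ℤ)) :
    galoisCohomology.res (A.torsionGaloisModule (p : ℤ)) (v.adicCompletion K) 1 (h1Equiv θ hθ c) =
      0 := by
  obtain ⟨𝔐, h𝔐⟩ := v.localPrimesAbove_nonempty
  have h𝔓 := HeightOneSpectrum.primeBelow_mem_primesAbove
    (ι := closureEmb (K := K) (v.adicCompletion K)) h𝔐
  have hpv' : (((p : ℤ)) : 𝓞 K) ∉ v.asIdeal := by rwa [Int.cast_natCast]
  have hurA : h1Equiv θ hθ c ∈ unramifiedKer (geomTorsion A (p : ℤ))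
      (v.primeBelow (closureEmb (K := K) (v.adicCompletion K)) 𝔐) := by
    rw [← A.selmerLocalKer_eq_unramifiedKer hA hpv' h𝔓]
    exact hcA
  have hur : c ∈ unramifiedKer (geomTorsion W (p : ℤ))
      (v.primeBelow (closureEmb (K := K) (v.adicCompletion K)) 𝔐) :=
    (mem_unramifiedKer_iff_h1Equiv_mem A W θ hθ _ c).mpr hurA
  exact res_h1Equiv_eq_zero_of_res_eq_zero W v A θ hθ
    (res_eq_zero_of_split_of_selmer_of_unramified W v hU hW hpv hq h𝔐 hc hur)

end Local

end Summit.BirchSwinnertonDyer.Rank1Residual.X11a.SelmerCompanion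

end
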